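import Mathlib
import HarnessLib
import Literature.NumberTheory.Transcendental.KZProductIdeal
import Summits.KontsevichZagierPeriods.KontsevichZagierPeriods.Theorems.MzvKernelInKZ.Negative.Core
import Summits.KontsevichZagierPeriods.KontsevichZagierPeriods.Theorems.MzvKernelInKZ.Negative.Divergence
import Summits.KontsevichZagierPeriods.KontsevichZagierPeriods.Theorems.MzvKernelInKZTwoPosetsDefs
import Summits.KontsevichZagierPeriods.KontsevichZagierPeriods.Theorems.MzvKernelInKZTwoPosetsShuffleProduct

/-!
# Stub `stub_productClosure` of line `tame-bv-stokes` (crux `DihedralNormalForm`)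

PRODUCTS OF NORMAL FORMS ARE NORMAL FORMS.  With `R = KZ.relations` and `W` the additive closure
of the MZV word representations `[Δ_w, q · ∏ᵢ ω_{εᵢ}(tᵢ)]` (the generating set
`MzvKernelInKZ.Negative.genSet`), the subgroup `R ⊔ W` of `KZ.FormalRep` is closed under the
product of representations: `KZ.of s₁ ∈ R ⊔ W → KZ.of s₂ ∈ R ⊔ W → KZ.of (s₁.prod s₂) ∈ R ⊔ W`.

Proof.
* `KZ.of (s₁.prod s₂) = KZ.of s₁ * KZ.of s₂` (`KZ.of_mul_of`; `*` is the biadditive product of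
  `FormalRep`), and `R` is a two-sided ideal (`KZ.mul_mem_relations_left_holds`,
  `KZ.mul_mem_relations_right_holds`), so it remains to see `W * W ⊆ R ⊔ W`, and by biadditivity
  (`AddSubgroup.closure_induction₂`) only for two generators `[s] = [Δ_w, q ω_ε]`,
  `[s'] = [Δ_{w'}, q' ω_{ε'}]`.
* `w' = 0`: `s.prod s'` is literally a word representation (coefficient `q q'`), so the product
  is a generator; `w = 0`: commute first (`KZ.mul_sub_mul_comm_mem_relations`).
* `w, w' > 0`, a non-admissible word: that factor is a relation (zero integrand,
  `Negative.of_mem_relations_of_not_adm`), hence so is the product (ideal).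
* `w, w' > 0`, both admissible: both factors are congruent to the canonical word representations
  (`Negative.of_sub_of_wordRep_mem_relations`, `KZ.mul_sub_mul_mem_relations`); the shuffle
  dissection `TwoPosets.stub_shuffleProduct` writes `[Δ_w, ω_ε] · [Δ_{w'}, ω_{ε'}]` as a sum of
  brackets `zWord` modulo `R`, and the scaling endomorphism `KZ.scale (q q')`
  (`KZ.scale_mem_relations`) transports this to the coefficients `q`, `q'`: the scaled product
  is congruent to `[Δ_w, q ω_ε] · [Δ_{w'}, q' ω_{ε'}]` (same domain, same integrand on it) and each
  scaled bracket is again a word representation (coefficient `q q'`) or `0`.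
-/

noncomputable section

namespace Summit.KontsevichZagierPeriods.DihedralNormalForm.TameBVStokes

open Set
open Literature.NumberTheory.Transcendental
open Summit.KontsevichZagierPeriods.MzvKernelInKZ.Negative
open Summit.KontsevichZagierPeriods.MzvKernelInKZ.TwoPosets

/-! ## The subgroup `relations ⊔ closure genSet` -/

/-- Relations are normal forms. -/
theorem relations_le_nfSubgroup : KZ.relations ≤ KZ.relations ⊔ AddSubgroup.closure genSet :=
  le_sup_left

/-- The MZV closure consists of normal forms. -/
theorem closure_le_nfSubgroup :
    AddSubgroup.closure genSet ≤ KZ.relations ⊔ AddSubgroup.closure genSet :=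
  le_sup_right

/-- Generators are normal forms. -/
theorem mem_nfSubgroup_of_mem_genSet {x : KZ.FormalRep} (hx : x ∈ genSet) :
    x ∈ KZ.relations ⊔ AddSubgroup.closure genSet :=
  closure_le_nfSubgroup (AddSubgroup.subset_closure hx)

/-- Membership in `relations ⊔ closure genSet` is invariant under congruence modulo relations. -/
theorem mem_nfSubgroup_of_sub_mem_relations {x y : KZ.FormalRep} (h : x - y ∈ KZ.relations)
    (hy : y ∈ KZ.relations ⊔ AddSubgroup.closure genSet) :
    x ∈ KZ.relations ⊔ AddSubgroup.closure genSet := by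
  have := add_mem (relations_le_nfSubgroup h) hy
  rwa [sub_add_cancel] at this

/-! ## Products of two generators -/

section Generators

variable {w w' : ℕ} {ε : Fin w → Bool} {ε' : Fin w' → Bool} {q q' : ℚ}

/-- A word representation times a ZERO-dimensional word representation `[pt, q']` is literally
a word representation (same word, coefficient `q q'`). -/
theorem of_prod_mem_genSet_of_zero (s : KZ.IntegralRep w) (s' : KZ.IntegralRep 0)
    (hd : s.domain = simplex w) (hi : EqOn s.integrand (wordFun ε q) s.domain)
    (hd' : s'.domain = simplex 0) {ε₀ : Fin 0 → Bool}
    (hi' : EqOn s'.integrand (wordFun ε₀ q') s'.domain) :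
    KZ.of (s.prod s') ∈ genSet := by
  have hdom : KZ.IntegralRep.prodDomain s s' = simplex w := by
    ext z
    simp only [KZ.IntegralRep.mem_prodDomain, hd, hd', simplex_zero, mem_univ, and_true,
      Fin.castAdd_zero, Fin.cast_refl, id_eq]
  refine ⟨w, ε, q * q', s.prod s', hdom, ?_, rfl⟩
  · intro z hz
    rw [KZ.IntegralRep.prod_domain, KZ.IntegralRep.mem_prodDomain] at hz
    rw [KZ.IntegralRep.prod_integrand_eq, KZ.IntegralRep.prodFun_apply, hi hz.1, hi' hz.2]
    simp only [wordFun, Finset.univ_eq_empty, Finset.prod_empty, mul_one, Fin.castAdd_zero,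
      Fin.cast_refl, id_eq, Rat.cast_mul]
    ring

/-- `[s] * [pt, q']` is a normal form. -/
theorem of_mul_of_mem_of_zero_right (s : KZ.IntegralRep w) (s' : KZ.IntegralRep 0)
    (hd : s.domain = simplex w) (hi : EqOn s.integrand (wordFun ε q) s.domain)
    (hd' : s'.domain = simplex 0) {ε₀ : Fin 0 → Bool}
    (hi' : EqOn s'.integrand (wordFun ε₀ q') s'.domain) :
    KZ.of s * KZ.of s' ∈ KZ.relations ⊔ AddSubgroup.closure genSet := by
  rw [KZ.of_mul_of]
  exact mem_nfSubgroup_of_mem_genSet (of_prod_mem_genSet_of_zero s s' hd hi hd' hi')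

/-- `[pt, q'] * [s]` is a normal form (commute modulo relations). -/
theorem of_mul_of_mem_of_zero_left (s : KZ.IntegralRep w) (s' : KZ.IntegralRep 0)
    (hd : s.domain = simplex w) (hi : EqOn s.integrand (wordFun ε q) s.domain)
    (hd' : s'.domain = simplex 0) {ε₀ : Fin 0 → Bool}
    (hi' : EqOn s'.integrand (wordFun ε₀ q') s'.domain) :
    KZ.of s' * KZ.of s ∈ KZ.relations ⊔ AddSubgroup.closure genSet :=
  mem_nfSubgroup_of_sub_mem_relations (KZ.mul_sub_mul_comm_mem_relations _ _)
    (of_mul_of_mem_of_zero_right s s' hd hi hd' hi')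

/-- A scaled canonical word representation is a generator (coefficient `c · a`). -/
theorem of_constMul_wordRep_mem_genSet (hε : Adm ε) (a c : ℚ) :
    KZ.of ((wordRep ε a hε).constMul (c : ℝ) (isAlgebraic_ratCast c)) ∈ genSet := by
  refine ⟨w, ε, c * a, _, rfl, fun t _ => ?_, rfl⟩
  simp only [KZ.IntegralRep.integrand_constMul, wordRep_integrand, wordFun, Rat.cast_mul]
  ring

/-- A scaled bracket `KZ.scale c (zWord N μ a)` is a normal form. -/
theorem scale_zWord_mem_nfSubgroup {N : ℕ} (μ : Fin N → Bool) (a c : ℚ) :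
    KZ.scale (c : ℝ) (isAlgebraic_ratCast c) (zWord N μ a) ∈
      KZ.relations ⊔ AddSubgroup.closure genSet := by
  unfold zWord
  split_ifs with h
  · rw [KZ.scale_of]
    exact mem_nfSubgroup_of_mem_genSet (of_constMul_wordRep_mem_genSet h a c)
  · rw [map_zero]
    exact zero_mem _

/-- **Both factors positive-dimensional and admissible**: the product of the two canonical word
representations is a normal form (shuffle dissection at coefficient `1`, transported to the
coefficients `q`, `q'` by the scaling endomorphism `KZ.scale (q q')`). -/
theorem of_wordRep_mul_of_wordRep_mem (hε : Adm ε) (hε' : Adm ε') (hw : 0 < w) (hw' : 0 < w')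
    (q q' : ℚ) : KZ.of (wordRep ε q hε) * KZ.of (wordRep ε' q' hε') ∈
      KZ.relations ⊔ AddSubgroup.closure genSet := by
  set c : ℚ := q * q' with hc
  have hS : KZ.of (wordRep ε 1 hε) * KZ.of (wordRep ε' 1 hε') -
      ((MZV.shuffleWord (List.ofFn ε) (List.ofFn ε')).map
        fun u => zWord (w + w') (wordOf (w + w') u) 1).sum ∈ KZ.relations :=
    stub_shuffleProduct w w' ε ε' hε hε' hw hw'
  have hsc := KZ.scale_mem_relations (c : ℝ) (isAlgebraic_ratCast c) hS
  rw [map_sub, map_list_sum, List.map_map, KZ.of_mul_of, KZ.scale_of] at hsc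
  -- the product at coefficients `q, q'` is congruent to the scaled product at coefficient `1`
  have hT : KZ.of (wordRep ε q hε) * KZ.of (wordRep ε' q' hε') -
      KZ.of (((wordRep ε 1 hε).prod (wordRep ε' 1 hε')).constMul (c : ℝ) (isAlgebraic_ratCast c)) ∈
        KZ.relations := by
    rw [KZ.of_mul_of]
    refine of_sub_of_mem_relations_of_eqOn rfl fun z _ => ?_
    simp only [KZ.IntegralRep.prod_integrand_eq, KZ.IntegralRep.integrand_constMul,
      KZ.IntegralRep.prodFun_apply, wordRep_integrand, wordFun, hc, Rat.cast_mul, Rat.cast_one]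
    ring
  have h := add_mem hT hsc
  rw [sub_add_sub_cancel] at h
  refine mem_nfSubgroup_of_sub_mem_relations h (list_sum_mem fun x hx => ?_)
  obtain ⟨u, -, rfl⟩ := List.mem_map.1 hx
  exact scale_zWord_mem_nfSubgroup _ 1 c

/-- **The product of two generators is a normal form.** -/
theorem mul_mem_nfSubgroup_of_mem_genSet {x y : KZ.FormalRep} (hx : x ∈ genSet)
    (hy : y ∈ genSet) : x * y ∈ KZ.relations ⊔ AddSubgroup.closure genSet := by
  obtain ⟨w, ε, q, s, hd, hi, rfl⟩ := hx
  obtain ⟨w', ε', q', s', hd', hi', rfl⟩ := hy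
  rcases Nat.eq_zero_or_pos w' with rfl | hw'
  · exact of_mul_of_mem_of_zero_right (ε := ε) (q := q) (q' := q') s s' hd hi hd' hi'
  rcases Nat.eq_zero_or_pos w with rfl | hw
  · exact of_mul_of_mem_of_zero_left (ε := ε') (q := q') (q' := q) s' s hd' hi' hd hi
  by_cases hε : Adm ε
  swap
  · exact relations_le_nfSubgroup
      (KZ.mul_mem_relations_right_holds _ _ (of_mem_relations_of_not_adm s hd hi hε))
  by_cases hε' : Adm ε'
  swap
  · exact relations_le_nfSubgroup
      (KZ.mul_mem_relations_left_holds _ _ (of_mem_relations_of_not_adm s' hd' hi' hε'))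
  exact mem_nfSubgroup_of_sub_mem_relations
    (KZ.mul_sub_mul_mem_relations (of_sub_of_wordRep_mem_relations hε s hd hi)
      (of_sub_of_wordRep_mem_relations hε' s' hd' hi'))
    (of_wordRep_mul_of_wordRep_mem hε hε' hw hw' q q')

end Generators

/-! ## Biadditive extension and the ideal property -/

/-- `W * W ⊆ relations ⊔ W` for the MZV closure `W` (biadditivity from the generator case). -/
theorem mul_mem_nfSubgroup_of_mem_closure {x y : KZ.FormalRep}
    (hx : x ∈ AddSubgroup.closure genSet) (hy : y ∈ AddSubgroup.closure genSet) :
    x * y ∈ KZ.relations ⊔ AddSubgroup.closure genSet := by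
  induction hx, hy using AddSubgroup.closure_induction₂ with
  | mem x y hx hy => exact mul_mem_nfSubgroup_of_mem_genSet hx hy
  | zero_left x _ => rw [zero_mul]; exact zero_mem _
  | zero_right x _ => rw [mul_zero]; exact zero_mem _
  | add_left x y z _ _ _ h₁ h₂ => rw [add_mul]; exact add_mem h₁ h₂
  | add_right y z x _ _ _ h₁ h₂ => rw [mul_add]; exact add_mem h₁ h₂
  | neg_left x y _ _ h => rw [neg_mul]; exact neg_mem h
  | neg_right x y _ _ h => rw [mul_neg]; exact neg_mem h

/-- **`relations ⊔ W` is closed under `*`** (`relations` is a two-sided ideal). -/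
theorem mul_mem_nfSubgroup {x y : KZ.FormalRep} (hx : x ∈ KZ.relations ⊔ AddSubgroup.closure genSet)
    (hy : y ∈ KZ.relations ⊔ AddSubgroup.closure genSet) :
    x * y ∈ KZ.relations ⊔ AddSubgroup.closure genSet := by
  obtain ⟨r, hr, u, hu, rfl⟩ := AddSubgroup.mem_sup.1 hx
  obtain ⟨r', hr', u', hu', rfl⟩ := AddSubgroup.mem_sup.1 hy
  rw [add_mul, mul_add u r' u']
  exact add_mem (relations_le_nfSubgroup (KZ.mul_mem_relations_right_holds _ _ hr))
    (add_mem (relations_le_nfSubgroup (KZ.mul_mem_relations_left_holds _ _ hr'))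
      (mul_mem_nfSubgroup_of_mem_closure hu hu'))

/-! ## The registered stub -/

/-- **stub_productClosure** (M–L). PRODUCTS OF NORMAL FORMS ARE NORMAL FORMS: `relations ⊔ closure
WordRep` is closed under the product of representations — `KZ.of (s₁.prod s₂) = KZ.of s₁ * KZ.of s₂`
(`KZ.of_mul_of`), `relations` is a two-sided ideal (`KZ.mul_mem_relations_left_holds`,
`KZ.mul_mem_relations_right_holds`), and a product of two word representations is a sum of word
representations by the shuffle dissection of `Δ_a × Δ_b` (rules 1a + 2; `ShuffleProductInKZ` of
Theorems/MzvKernelInKZTwoPosetsShuffleProduct.lean; empty and non-admissible words: constants resp.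
zero integrands). -/
theorem stub_productClosure : ∀ (a b : ℕ) (s₁ : Literature.NumberTheory.Transcendental.KZ.IntegralRep a) (s₂ : Literature.NumberTheory.Transcendental.KZ.IntegralRep b), Literature.NumberTheory.Transcendental.KZ.of s₁ ∈ Literature.NumberTheory.Transcendental.KZ.relations ⊔ AddSubgroup.closure {x : Literature.NumberTheory.Transcendental.KZ.FormalRep | ∃ (w : ℕ) (ε : Fin w → Bool) (q : ℚ) (s : Literature.NumberTheory.Transcendental.KZ.IntegralRep w), s.domain = {t : Fin w → ℝ | (∀ i, 0 < t i) ∧ (∀ i, t i < 1) ∧ StrictAnti t} ∧ Set.EqOn s.integrand (fun t => (q : ℝ) * ∏ i, if ε i then 1 / (1 - t i) else 1 / t i) s.domain ∧ x = Literature.NumberTheory.Transcendental.KZ.of s} → Literature.NumberTheory.Transcendental.KZ.of s₂ ∈ Literature.NumberTheory.Transcendental.KZ.relations ⊔ AddSubgroup.closure {x : Literature.NumberTheory.Transcendental.KZ.FormalRep | ∃ (w : ℕ) (ε : Fin w → Bool) (q : ℚ) (s : Literature.NumberTheory.Transcendental.KZ.IntegralRep w), s.domain = {t : Fin w → ℝ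 | (∀ i, 0 < t i) ∧ (∀ i, t i < 1) ∧ StrictAnti t} ∧ Set.EqOn s.integrand (fun t => (q : ℝ) * ∏ i, if ε i then 1 / (1 - t i) else 1 / t i) s.domain ∧ x = Literature.NumberTheory.Transcendental.KZ.of s} → Literature.NumberTheory.Transcendental.KZ.of (s₁.prod s₂) ∈ Literature.NumberTheory.Transcendental.KZ.relations ⊔ AddSubgroup.closure {x : Literature.NumberTheory.Transcendental.KZ.FormalRep | ∃ (w : ℕ) (ε : Fin w → Bool) (q : ℚ) (s : Literature.NumberTheory.Transcendental.KZ.IntegralRep w), s.domain = {t : Fin w → ℝ | (∀ i, 0 < t i) ∧ (∀ i, t i < 1) ∧ StrictAnti t} ∧ Set.EqOn s.integrand (fun t => (q : ℝ) * ∏ i, if ε i then 1 / (1 - t i) else 1 / t i) s.domain ∧ x = Literature.NumberTheory.Transcendental.KZ.of s} := by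
  intro a b s₁ s₂ h₁ h₂
  rw [← KZ.of_mul_of]
  exact mul_mem_nfSubgroup h₁ h₂

end Summit.KontsevichZagierPeriods.DihedralNormalForm.TameBVStokes
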